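import Summits.Ventures.WeilGRH.UniformConductorFloorJointCertDefs
import Summits.Ventures.WeilGRH.UniformConductorFloorJointCells
import HarnessLib

/-!
# GRH arm (rh-explicit, venture WeilGRH): soundness of the joint cell certificate checker, I — lists, cells, the vector `φ`

Cell `rh-explicit`, WEIL TRACK — GRH ARM (weil-grh-1).  For a `JointCert c` (`UniformConductorFloorJointCertDefs.lean`):

* `dotN_map_range'` — the truncated dot product against a tabulated list is a `Finset` sum;
* `cellsLoop_spec` — the zipper `cellsRange j0 cnt` proves the specification `cellOKB j` of every cell `j0 ≤ j < j0 + cnt`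
  (the running lists ARE the specification lists: `lList_succ`, `rList_tail`);
* `phi_pos`/`phi_le`/`phi_out` — the shape of the real step vector `c.φ` from `checkShape ∧ checkPhi`;
* `hcert_of_cellOKB` — `cellOKB j` is, after division by `D`, exactly the `j`-th hypothesis of
  `UniformFloor.trivialKeyFormTrunc_ge_of_joint_cert` for the data `(c.φ, c.sfun, c.wbar, c.Ibar, c.ρ)` (the slab terms
  `k ≥ J` vanish because the pair weights do).

Everything is PROVED; no definitions; no named facts. [folklore]
-/

noncomputable section

open Real MeasureTheory Finset

namespace Summit.Ventures.WeilGRH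

namespace UniformFloor

/-! ## List lemmas -/

/-- `dotN as [] = 0`. [folklore] -/
theorem dotN_nil_right : ∀ as : List ℕ, dotN as [] = 0
  | [] => rfl
  | _ :: _ => rfl

/-- The truncated dot product against `[f s, f (s+1), …]` of length `≥ |as|` is `Σ_{i<|as|} as_i f(s+i)`. [folklore] -/
theorem dotN_map_range' (f : ℕ → ℕ) : ∀ (as : List ℕ) (s n : ℕ), as.length ≤ n →
    dotN as ((List.range' s n).map f) = ∑ i ∈ range as.length, as.getD i 0 * f (s + i)
  | [], s, n, _ => by simp [dotN]
  | a :: as, s, 0, h => by simp at h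
  | a :: as, s, n + 1, h => by
    rw [List.range'_succ, List.map_cons, dotN, List.length_cons, sum_range_succ', dotN_map_range' f as (s + 1) n
      (by simpa using h)]
    simp only [List.getD_cons_succ, List.getD_cons_zero, add_zero]
    rw [add_comm]
    congr 1
    exact sum_congr rfl fun i _ ↦ by rw [show s + 1 + i = s + (i + 1) by omega]

/-- A list sum over `range' 0 n` is a `Finset.range` sum. [folklore] -/
theorem sum_map_range'_zero (f : ℕ → ℕ) : ∀ n : ℕ, ((List.range' 0 n).map f).sum = ∑ i ∈ range n, f i
  | 0 => by simp
  | n + 1 => by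
    rw [List.range'_concat, List.map_append, List.sum_append, sum_map_range'_zero f n, sum_range_succ]
    simp

/-- Membership in a `List.all` over `range' s n`. [folklore] -/
theorem of_all_range' {p : ℕ → Bool} {s n : ℕ} (h : (List.range' s n).all p = true) {i : ℕ} (hs : s ≤ i)
    (hi : i < s + n) : p i = true := by
  rw [List.all_eq_true] at h
  exact h i (List.mem_range'_1.2 ⟨hs, hi⟩)

/-- Shifting the start of `range'` by one is composing with the successor. [folklore] -/
theorem map_range'_succ {α : Type*} (f : ℕ → α) : ∀ (s n : ℕ),
    (List.range' (s + 1) n).map f = (List.range' s n).map (fun i ↦ f (i + 1))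
  | _, 0 => rfl
  | s, n + 1 => by
    rw [List.range'_succ, List.range'_succ, List.map_cons, List.map_cons, map_range'_succ f (s + 1) n]

namespace JointCert

variable (c : JointCert)

/-! ## The zipper proves the specification of every cell -/

/-- One step of the reversed-prefix list. [folklore] -/
theorem lList_succ (j n : ℕ) : c.lList (j + 1) (n + 1) = c.mx ((j : ℤ) - c.k0) :: c.lList j n := by
  unfold lList
  rw [List.range'_succ, List.map_cons, map_range'_succ]
  congr 1
  · congr 1
    push_cast
    ring
  · refine List.map_congr_left fun i _ ↦ ?_
    congr 1
    push_cast
    ring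

/-- One step of the suffix list. [folklore] -/
theorem rList_tail (j n : ℕ) : (c.rList j (n + 1)).tail = c.rList (j + 1) n := by
  unfold rList
  rw [List.range'_succ, List.map_cons, List.tail_cons, map_range'_succ]
  refine List.map_congr_left fun i _ ↦ ?_
  congr 1
  push_cast
  ring

/-- **The zipper is the specification**: `cellsRange j0 cnt = true` gives `cellOKB j` for `j0 ≤ j < j0 + cnt`
(as long as `j0 + cnt ≤ 2J`). [folklore] -/
theorem cellsLoop_spec : ∀ (cnt j0 : ℕ), j0 + cnt ≤ 2 * c.J → c.cellsRange j0 cnt = true →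
    ∀ j, j0 ≤ j → j < j0 + cnt → c.cellOKB j = true
  | 0, j0, _, _, j, h1, h2 => by omega
  | cnt + 1, j0, hb, h, j, h1, h2 => by
    unfold cellsRange at h
    rw [cellsLoop, Bool.and_eq_true] at h
    rcases eq_or_lt_of_le h1 with rfl | hlt
    · unfold cellOKB; exact h.1
    · have e1 : c.mx ((j0 : ℤ) - c.k0) :: c.lList j0 (c.J - c.k0 + j0) = c.lList (j0 + 1) (c.J - c.k0 + (j0 + 1)) := by
        rw [show c.J - c.k0 + (j0 + 1) = (c.J - c.k0 + j0) + 1 by omega, lList_succ]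
      have e2 : (c.rList j0 (2 * c.J - j0)).tail = c.rList (j0 + 1) (2 * c.J - (j0 + 1)) := by
        rw [show 2 * c.J - j0 = (2 * c.J - (j0 + 1)) + 1 by omega, rList_tail]
      rw [e1, e2] at h
      exact cellsLoop_spec cnt (j0 + 1) (by omega) h.2 j (by omega) (by omega)

/-- All cells from `checkCells`. [folklore] -/
theorem cellOKB_of_checkCells (h : c.checkCells = true) {j : ℕ} (hj : j < c.J) : c.cellOKB j = true :=
  c.cellsLoop_spec c.J 0 (by omega) h j (Nat.zero_le _) (by omega)

/-! ## The shape facts -/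

/-- Unpacking `checkShape`. [folklore] -/
theorem shape_of_checkShape (h : c.checkShape = true) :
    2 ≤ c.R ∧ c.k0 < c.J ∧ c.J ≤ c.K ∧ c.κ ≤ 1 ∧ 0 < c.D ∧ 0 < c.M ∧ c.phi.length = c.J ∧
      c.shifts.length = c.N + 1 ∧ c.weights.length = c.N + 1 ∧ c.slabB.length = c.J - c.k0 ∧ 0 < c.L ∧
      ∀ m < c.M, c.aexp m ∣ c.L := by
  unfold checkShape at h
  simp only [Bool.and_eq_true, decide_eq_true_eq] at h
  obtain ⟨⟨⟨⟨⟨⟨⟨⟨⟨⟨⟨h1, h2⟩, h3⟩, h4⟩, h5⟩, h6⟩, h7⟩, h8⟩, h9⟩, h10⟩, h11⟩, h12⟩ := h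
  refine ⟨h1, h2, h3, h4, h5, h6, h7, h8, h9, h10, h11, fun m hm ↦ ?_⟩
  have := of_all_range' h12 (Nat.zero_le m) (by simpa using hm)
  exact Nat.dvd_of_mod_eq_zero (by simpa using this)

/-! ## The real step vector -/

/-- `c.φ i = c.phiAt i` as real numbers (given `|phi| = J`). [folklore] -/
theorem phi_eq_phiAt (hlen : c.phi.length = c.J) (i : ℤ) : c.φ i = (c.phiAt i : ℝ) := by
  unfold φ phiAt
  by_cases h0 : i < 0
  · rw [if_neg (by omega), if_pos h0, Nat.cast_zero]
  rw [if_neg h0]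
  by_cases hJ : i < (c.J : ℤ)
  · rw [if_pos ⟨by omega, hJ⟩]
  · rw [if_neg (by omega), List.getD_eq_default _ _ (by rw [hlen]; omega), Nat.cast_zero]

/-- `max(φ_a, φ_b)` is the cast of the integer `max`. [folklore] -/
theorem max_phi_eq (hlen : c.phi.length = c.J) (a b : ℤ) :
    max (c.φ a) (c.φ b) = ((max (c.phiAt a) (c.phiAt b) : ℕ) : ℝ) := by
  rw [c.phi_eq_phiAt hlen, c.phi_eq_phiAt hlen, Nat.cast_max]

/-- The real pair weight of shift `s` at cell `j` is the cast of `pairAt s j`. [folklore] -/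
theorem pair_eq_pairAt (hlen : c.phi.length = c.J) (s j : ℕ) :
    max (c.φ ((j : ℤ) - s - 1)) (c.φ ((j : ℤ) - s)) + max (c.φ ((j : ℤ) + s)) (c.φ ((j : ℤ) + s + 1)) =
      (c.pairAt s j : ℝ) := by
  have e : (j : ℤ) - s - 1 + 1 = (j : ℤ) - s := by ring
  unfold pairAt mx
  rw [e, c.max_phi_eq hlen, c.max_phi_eq hlen, Nat.cast_add]

/-- `1 ≤ φ_i` on `[0, J)`. [folklore] -/
theorem phi_pos (hlen : c.phi.length = c.J) (hphi : c.checkPhi = true) (i : ℤ) (h0 : 0 ≤ i) (hJ : i < (c.J : ℤ)) :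
    (1 : ℝ) ≤ c.φ i := by
  unfold φ
  rw [if_pos ⟨h0, hJ⟩]
  have hi : i.toNat < c.phi.length := by rw [hlen]; omega
  rw [List.getD_eq_getElem _ _ hi]
  unfold checkPhi at hphi
  have := List.all_eq_true.1 hphi _ (List.getElem_mem hi)
  simp only [Bool.and_eq_true, decide_eq_true_eq] at this
  exact_mod_cast this.1

/-- `φ_i ≤ PhiMax`. [folklore] -/
theorem phi_le (hlen : c.phi.length = c.J) (hphi : c.checkPhi = true) (i : ℤ) : c.φ i ≤ (c.PhiMax : ℝ) := by
  unfold φ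
  split_ifs with h
  · have hi : i.toNat < c.phi.length := by rw [hlen]; omega
    rw [List.getD_eq_getElem _ _ hi]
    unfold checkPhi at hphi
    have := List.all_eq_true.1 hphi _ (List.getElem_mem hi)
    simp only [Bool.and_eq_true, decide_eq_true_eq] at this
    exact_mod_cast this.2
  · exact Nat.cast_nonneg _

/-- `φ_i = 0` off `[0, J)`. [folklore] -/
theorem phi_out (i : ℤ) (h : i < 0 ∨ (c.J : ℤ) ≤ i) : c.φ i = 0 := by
  unfold φ
  rw [if_neg (by omega)]

/-- The pair weight vanishes for slab indices `k ≥ J` (cell `j < J`). [folklore] -/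
theorem pair_eq_zero_of_le {j k : ℕ} (hj : j < c.J) (hk : c.J ≤ k) :
    max (c.φ ((j : ℤ) - k - 1)) (c.φ ((j : ℤ) - k)) + max (c.φ ((j : ℤ) + k)) (c.φ ((j : ℤ) + k + 1)) = 0 := by
  have hlenZ : (c.J : ℤ) ≤ k := by exact_mod_cast hk
  rw [c.phi_out _ (Or.inl (by omega)), c.phi_out _ (Or.inl (by omega)), c.phi_out _ (Or.inr (by omega)),
    c.phi_out _ (Or.inr (by omega)), max_self, add_zero]

/-! ## The cell hypothesis of the analytic theorem -/

/-- **`cellOKB j` is the `j`-th cell hypothesis** of `trivialKeyFormTrunc_ge_of_joint_cert` for the data of `c`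
(after division by `D`; the slabs `k ≥ J` contribute nothing). [folklore] -/
theorem hcert_of_cellOKB (hsh : c.checkShape = true) {j : ℕ} (hj : j < c.J) (hcell : c.cellOKB j = true) :
    ∑ n ∈ range (c.N + 1), c.wbar n *
        (max (c.φ ((j : ℤ) - c.sfun n - 1)) (c.φ ((j : ℤ) - c.sfun n)) +
          max (c.φ ((j : ℤ) + c.sfun n)) (c.φ ((j : ℤ) + c.sfun n + 1))) +
      ∑ k ∈ Ico c.k0 c.K, c.Ibar k *
        (max (c.φ ((j : ℤ) - k - 1)) (c.φ ((j : ℤ) - k)) + max (c.φ ((j : ℤ) + k)) (c.φ ((j : ℤ) + k + 1))) ≤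
      c.ρ * c.φ (j : ℤ) := by
  obtain ⟨_, hk0, hJK, _, hD, _, hlen, _, _, hslab, _⟩ := c.shape_of_checkShape hsh
  have hD' : (0 : ℝ) < c.D := by exact_mod_cast hD
  -- the integer inequality
  unfold cellOKB at hcell
  rw [decide_eq_true_eq] at hcell
  have hZ : ((c.atomSum j : ℕ) : ℝ) + (dotN c.slabB (c.lList j (c.J - c.k0 + j)) : ℕ) +
      (dotN c.slabB (c.rList j (2 * c.J - j)) : ℕ) ≤ (c.RHO : ℝ) * c.phiAt j := by exact_mod_cast hcell
  -- (1) the prime part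
  have hP : ∑ n ∈ range (c.N + 1), c.wbar n *
      (max (c.φ ((j : ℤ) - c.sfun n - 1)) (c.φ ((j : ℤ) - c.sfun n)) +
        max (c.φ ((j : ℤ) + c.sfun n)) (c.φ ((j : ℤ) + c.sfun n + 1))) = (c.atomSum j : ℝ) / c.D := by
    unfold atomSum wbar sfun
    rw [sum_map_range'_zero, Nat.cast_sum, sum_div]
    refine sum_congr rfl fun n _ ↦ ?_
    rw [c.pair_eq_pairAt hlen, Nat.cast_mul]
    ring
  -- (2) the slab part: split `Ico k0 K` at `J`
  have hS : ∑ k ∈ Ico c.k0 c.K, c.Ibar k *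
      (max (c.φ ((j : ℤ) - k - 1)) (c.φ ((j : ℤ) - k)) + max (c.φ ((j : ℤ) + k)) (c.φ ((j : ℤ) + k + 1))) =
      ((dotN c.slabB (c.lList j (c.J - c.k0 + j)) : ℕ) + (dotN c.slabB (c.rList j (2 * c.J - j)) : ℕ) : ℝ) / c.D := by
    rw [← sum_Ico_consecutive _ hk0.le hJK]
    have hz : ∑ k ∈ Ico c.J c.K, c.Ibar k *
        (max (c.φ ((j : ℤ) - k - 1)) (c.φ ((j : ℤ) - k)) + max (c.φ ((j : ℤ) + k)) (c.φ ((j : ℤ) + k + 1))) = 0 :=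
      sum_eq_zero fun k hk ↦ by rw [c.pair_eq_zero_of_le hj (mem_Ico.1 hk).1, mul_zero]
    rw [hz, add_zero, sum_Ico_eq_sum_range]
    unfold lList rList
    rw [dotN_map_range' _ _ _ _ (by rw [hslab]; omega), dotN_map_range' _ _ _ _ (by rw [hslab]; omega), hslab]
    push_cast
    rw [add_div, sum_div, sum_div, ← sum_add_distrib]
    refine sum_congr rfl fun i hi ↦ ?_
    have hiJ : c.k0 + i < c.J := by have := mem_range.1 hi; omega
    unfold Ibar mx
    rw [if_pos hiJ, Nat.add_sub_cancel_left, c.max_phi_eq hlen, c.max_phi_eq hlen]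
    push_cast
    ring_nf
  rw [hP, hS, c.phi_eq_phiAt hlen]
  unfold ρ
  rw [← add_div, div_mul_eq_mul_div]
  exact div_le_div_of_nonneg_right (by linarith) hD'.le

end JointCert

end UniformFloor

end Summit.Ventures.WeilGRH

end
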